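import Summits.ResolutionOfSingularities.ResolutionOfSingularities.Theorems.WeightedInvariantSingularLocusHomogeneous
import Summits.ResolutionOfSingularities.ResolutionOfSingularities.Theorems.WeightedInvariantGradedSimpleOrbitCharts
import HarnessLib

/-!
# Torus-stable closed subsets of a graded chart have homogeneous reduced ideals (and conversely)

Route `ResolutionOfSingularities/WeightedInvariant`, door crux `HypersurfaceCentreConstruction`
(stmt-ResolutionOfSingularities-19897), e-ladder `e = 1` of `res-L1-w43-stub-10`, item **T-e1-L0 «orbit
extension»**, piece (P-b) part 2 (cell res-hironaka, `D/res-D-pv-025/DOOR-ELADDER-PLAN.md` v1.1 §6).  Companion of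
`Theorems/WeightedInvariantGradedSimpleOrbitCharts.lean`: that file reduces «a torus-stable open `Ω ∋ η_𝒬` contains
the whole closed orbit `𝒬`» to the HOMOGENEITY of the reduced chart ideals `𝓘(𝒬 ∖ Ω)(W)`; this file supplies
that homogeneity from torus-stability read on the chart, in the graded encoding of the torus action used by the
route (`Theorems.GradedAtlas`; coaction `ρ : A → A[ℤʲ]` of a `ℤʲ`-grading `𝒜` of `A = Γ(Y, W)`,
`DatumToEmbedded.CentreHomogeneous.exists_coaction`; action and projection
`act = Spec ρ ≫ (W ⊆ Y)`, `pr = Spec ι₀ ≫ (W ⊆ Y) : 𝔾ₘʲ × W → Y`):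

* `comap_vanishingIdeal_of_smooth` — for a smooth `g : T → Y` of a locally Noetherian `Y` and a closed
  `S ⊆ Y`, `g* 𝓘(S) = 𝓘(g⁻¹ S)` (the pull-back of a reduced closed subscheme along a smooth morphism is
  reduced, Stacks 034E; = the mechanism of `comap_vanishingIdeal_singSet_of_smooth`, freed from the singular
  locus);
* `preimage_SpecMap_fromSpec_zeroLocus`, `preimage_SpecMap_fromSpec_closeds` — the preimage of `V(J) ∩ W`,
  resp. of a closed `C`, under `Spec R → Spec Γ(Y, W) → Y` is `V(J · R)`, resp. `V(𝓘(C)(W) · R)`;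
* `preimage_act_eq_preimage_pr_of_isHomogeneous` — **homogeneous ⇒ torus-stable**: if `J ≤ Γ(Y, W)` is
  homogeneous then `act⁻¹ V(J) = pr⁻¹ V(J)` (`ρ(J) · A[ℤʲ] = J · A[ℤʲ]`,
  `map_coaction_eq_of_isHomogeneous`); `preimage_act_closeds_eq_of_isHomogeneous` — the same for a closed `C`
  with `𝓘(C)(W)` homogeneous;
* `vanishingIdeal_isHomogeneous_of_preimage_act_eq` — **torus-stable ⇒ homogeneous**: if `act⁻¹ C = pr⁻¹ C`
  then `𝓘(C)(W)` is homogeneous (`Y` locally Noetherian; both smooth maps pull `𝓘(C)` back to the reduced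
  ideal of the common preimage; read on the torus chart, `isHomogeneous_of_map_coaction_le`) — Włodarczyk's
  «functoriality for group actions» for an arbitrary stable closed set;
* `vanishingIdeal_inf_compl_isHomogeneous` — for `Z` closed with `𝓘(Z)(W)` homogeneous and `Ω` open with
  `act⁻¹ Ω = pr⁻¹ Ω`, the closed set `Z ∖ Ω` has homogeneous `𝓘(Z ⊓ Ωᶜ)(W)`;
* `closeds_subset_opens_of_gradedSimple_of_stable` — **TORUS-STABLE OPENS SWALLOW CLOSED ORBITS**: `Z ⊆ Y`
  closed irreducible with generic point `η`, covered by affine charts `W a` with `ℤʲ`-gradings and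
  coactions `ρ a` such that `𝓘(Z)(W a)` is homogeneous with graded-simple quotient (a closed orbit with
  finite stabilisers); then every open `Ω ∋ η` with `act_a⁻¹ Ω = pr_a⁻¹ Ω` for all `a` contains `Z`.

Pure scheme-theoretic plumbing over Mathlib and the route's own algebra; nothing here is a claim about
Hironaka's problem and no statement of H. Hironaka's manuscript is used.  AI-written; weaker than expert review.
References: Stacks 034E [StacksProject]; Włodarczyk arXiv:2203.03090 Thm. 1.1.4 (6) [Wlodarczyk2022].
-/

noncomputable section

open CategoryTheory CategoryTheory.Limits AlgebraicGeometry TopologicalSpace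
open Literature.AlgebraicGeometry.Resolution

set_option linter.dupNamespace false -- mandated namespace of this single-conjunct summit

namespace Summit.ResolutionOfSingularities.ResolutionOfSingularities.Theorems

universe u

open Scheme.IdealSheafData

/-! ## §1 Smooth pull-back of a reduced vanishing ideal -/

/-- **Smooth pull-back of the reduced ideal of a closed set**: for a smooth `g : T → Y` with `Y` locally
Noetherian and a closed `S ⊆ Y`, `g* 𝓘(S) = 𝓘(g⁻¹ S)` — the pull-back of the reduced closed subscheme `S` is
reduced (Stacks 034E) with support `g⁻¹ S`. [cite: StacksProject, Tag 034E] -/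
theorem comap_vanishingIdeal_of_smooth {T Y : Scheme.{u}} (g : T ⟶ Y) [Smooth g] [IsLocallyNoetherian Y]
    (S : Closeds Y) :
    (vanishingIdeal S).comap g = vanishingIdeal (S.preimage g.continuous) := by
  set J := vanishingIdeal S with hJ
  haveI : IsReduced J.subscheme := isReduced_subscheme_vanishingIdeal S
  haveI : IsLocallyNoetherian J.subscheme := LocallyOfFiniteType.isLocallyNoetherian J.subschemeι
  haveI : IsReduced (pullback g J.subschemeι) :=
    isReduced_of_smooth_of_isReduced_base (pullback.snd g J.subschemeι)
  haveI : IsReduced (J.comap g).subscheme := isReduced_of_isOpenImmersion (J.comapIso g).hom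
  rw [← eq_vanishingIdeal_support_of_isReduced_subscheme (J.comap g)]
  congr 1
  apply Closeds.ext
  rw [support_comap, Closeds.coe_preimage, hJ, coe_support_vanishingIdeal, Closeds.coe_preimage]

/-! ## §2 Preimages under a chart map `Spec R → Spec Γ(Y, W) → Y` -/

section Chart

variable {Y : Scheme.{u}} (W : Y.affineOpens) {R : CommRingCat.{u}} (φ : Γ(Y, W) ⟶ R)

/-- The preimage of `V(J)` (`J ≤ Γ(Y, W)`) under `Spec R → Spec Γ(Y, W) → Y` is `V(J · R)`. [folklore] -/
theorem preimage_SpecMap_fromSpec_zeroLocus (J : Ideal Γ(Y, W)) :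
    (Spec.map φ ≫ W.2.fromSpec) ⁻¹' Y.zeroLocus (U := W) (J : Set Γ(Y, W)) =
      PrimeSpectrum.zeroLocus ((J.map φ.hom : Ideal R) : Set R) := by
  ext x
  rw [Set.mem_preimage, Scheme.Hom.comp_apply, ← Set.mem_preimage, IsAffineOpen.fromSpec_preimage_zeroLocus]
  change (J : Set Γ(Y, W)) ⊆ (PrimeSpectrum.comap φ.hom x).asIdeal ↔ ((J.map φ.hom : Ideal R) : Set R) ⊆ x.asIdeal
  rw [PrimeSpectrum.comap_asIdeal, SetLike.coe_subset_coe, SetLike.coe_subset_coe, Ideal.map_le_iff_le_comap]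

/-- Points of `Spec R` map into `W` under `Spec R → Spec Γ(Y, W) → Y`. [folklore] -/
theorem SpecMap_fromSpec_apply_mem (x : Spec R) : (Spec.map φ ≫ W.2.fromSpec) x ∈ (W : Set Y) := by
  rw [Scheme.Hom.comp_apply, ← IsAffineOpen.range_fromSpec W.2]
  exact Set.mem_range_self _

/-- The preimage of a closed `C ⊆ Y` under `Spec R → Spec Γ(Y, W) → Y` is `V(𝓘(C)(W) · R)`, `𝓘(C)` the
reduced ideal sheaf of `C`. [folklore] -/
theorem preimage_SpecMap_fromSpec_closeds (C : Closeds Y) :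
    (Spec.map φ ≫ W.2.fromSpec) ⁻¹' (C : Set Y) =
      PrimeSpectrum.zeroLocus ((((vanishingIdeal C).ideal W).map φ.hom : Ideal R) : Set R) := by
  rw [← preimage_SpecMap_fromSpec_zeroLocus]
  ext x
  have hxW := SpecMap_fromSpec_apply_mem W φ x
  simp only [Set.mem_preimage]
  constructor
  · intro hx
    have h : (Spec.map φ ≫ W.2.fromSpec) x ∈ (C : Set Y) ∩ W := ⟨hx, hxW⟩
    rw [closeds_inter_eq_zeroLocus_vanishingIdeal W C] at h
    exact h.1
  · intro hx
    have h : (Spec.map φ ≫ W.2.fromSpec) x ∈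
        Y.zeroLocus (U := W) (((vanishingIdeal C).ideal W : Ideal Γ(Y, W)) : Set Γ(Y, W)) ∩ W := ⟨hx, hxW⟩
    rw [← closeds_inter_eq_zeroLocus_vanishingIdeal W C] at h
    exact h.1

end Chart

/-! ## §3 Torus charts: homogeneous ⟺ stable -/

section Torus

open DatumToEmbedded.CentreHomogeneous AddMonoidAlgebra

variable {Y : Scheme.{u}} {j : ℕ} (W : Y.affineOpens) (𝒜 : (Fin j → ℤ) → AddSubgroup Γ(Y, W)) [GradedRing 𝒜]
  (ρ : (Γ(Y, W) : Type u) →+* (Γ(Y, W) : Type u)[Fin j → ℤ])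
  (hρ : ∀ (i : Fin j → ℤ) (a : Γ(Y, W)), a ∈ 𝒜 i → ρ a = single i a)
include hρ

/-- **Homogeneous ⇒ torus-stable**: if `J ≤ Γ(Y, W)` is homogeneous for the `ℤʲ`-grading with coaction `ρ`,
the action and the projection `𝔾ₘʲ × W → Y` have the same preimage of `V(J)`
(`ρ(J) · A[ℤʲ] = J · A[ℤʲ]`). [folklore] -/
theorem preimage_act_eq_preimage_pr_of_isHomogeneous {J : Ideal Γ(Y, W)} (hJ : J.IsHomogeneous 𝒜) :
    (Spec.map (CommRingCat.ofHom ρ) ≫ W.2.fromSpec) ⁻¹' Y.zeroLocus (U := W) (J : Set Γ(Y, W)) =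
      (Spec.map (CommRingCat.ofHom (singleZeroRingHom : Γ(Y, W) →+* (Γ(Y, W) : Type u)[Fin j → ℤ])) ≫
        W.2.fromSpec) ⁻¹' Y.zeroLocus (U := W) (J : Set Γ(Y, W)) := by
  rw [preimage_SpecMap_fromSpec_zeroLocus, preimage_SpecMap_fromSpec_zeroLocus, CommRingCat.hom_ofHom,
    CommRingCat.hom_ofHom, map_coaction_eq_of_isHomogeneous 𝒜 ρ hρ hJ]

/-- **Homogeneous ⇒ torus-stable, closed sets**: a closed `C ⊆ Y` whose reduced chart ideal `𝓘(C)(W)` is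
homogeneous has the same preimage under the action and the projection `𝔾ₘʲ × W → Y`. [folklore] -/
theorem preimage_act_closeds_eq_of_isHomogeneous (C : Closeds Y)
    (hC : ((vanishingIdeal C).ideal W).IsHomogeneous 𝒜) :
    (Spec.map (CommRingCat.ofHom ρ) ≫ W.2.fromSpec) ⁻¹' (C : Set Y) =
      (Spec.map (CommRingCat.ofHom (singleZeroRingHom : Γ(Y, W) →+* (Γ(Y, W) : Type u)[Fin j → ℤ])) ≫
        W.2.fromSpec) ⁻¹' (C : Set Y) := by
  rw [preimage_SpecMap_fromSpec_closeds, preimage_SpecMap_fromSpec_closeds, CommRingCat.hom_ofHom,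
    CommRingCat.hom_ofHom, map_coaction_eq_of_isHomogeneous 𝒜 ρ hρ hC]

/-- **Torus-stable ⇒ homogeneous**: let `Y` be locally Noetherian, `W ⊆ Y` an affine open with a
`ℤʲ`-grading `𝒜` of `Γ(Y, W)` and coaction `ρ`, and `C ⊆ Y` a closed set with the same preimage under the
action `act = Spec ρ ≫ (W ⊆ Y)` and the projection `pr = Spec ι₀ ≫ (W ⊆ Y)` of the torus chart `𝔾ₘʲ × W`.
Then the reduced chart ideal `𝓘(C)(W)` is homogeneous: both maps are smooth, so pull `𝓘(C)` back to the
reduced ideal of the common preimage (`comap_vanishingIdeal_of_smooth`); on the torus chart this reads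
`ρ(𝓘(C)(W)) · A[ℤʲ] = 𝓘(C)(W) · A[ℤʲ]`, which forces homogeneity (`isHomogeneous_of_map_coaction_le`).
[cite: Wlodarczyk2022, Thm. 1.1.4 (6)] -/
theorem vanishingIdeal_isHomogeneous_of_preimage_act_eq [IsLocallyNoetherian Y] (C : Closeds Y)
    (hC : (Spec.map (CommRingCat.ofHom ρ) ≫ W.2.fromSpec) ⁻¹' (C : Set Y) =
      (Spec.map (CommRingCat.ofHom (singleZeroRingHom : Γ(Y, W) →+* (Γ(Y, W) : Type u)[Fin j → ℤ])) ≫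
        W.2.fromSpec) ⁻¹' (C : Set Y)) :
    ((vanishingIdeal C).ideal W).IsHomogeneous 𝒜 := by
  let L : Type u := (Γ(Y, W) : Type u)[Fin j → ℤ]
  let T : Scheme.{u} := Spec (.of L)
  let φa : Γ(Y, W) ⟶ CommRingCat.of L := CommRingCat.ofHom ρ
  let φp : Γ(Y, W) ⟶ CommRingCat.of L := CommRingCat.ofHom singleZeroRingHom
  let act : T ⟶ Y := Spec.map φa ≫ W.2.fromSpec
  let pr : T ⟶ Y := Spec.map φp ≫ W.2.fromSpec
  haveI : Smooth (Spec.map φa) :=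
    (HasRingHomProperty.Spec_iff (P := @Smooth)).mpr (smooth_coaction 𝒜 ρ hρ)
  haveI : Smooth (Spec.map φp) :=
    (HasRingHomProperty.Spec_iff (P := @Smooth)).mpr (smooth_singleZeroRingHom _ j)
  haveI : Smooth act := inferInstance
  haveI : Smooth pr := inferInstance
  have hpre : C.preimage act.continuous = C.preimage pr.continuous := by
    apply Closeds.ext
    rw [Closeds.coe_preimage, Closeds.coe_preimage]
    exact hC
  have hcomap : (vanishingIdeal C).comap act = (vanishingIdeal C).comap pr := by
    rw [comap_vanishingIdeal_of_smooth act C, comap_vanishingIdeal_of_smooth pr C, hpre]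
  -- read on the torus chart
  have hC' := congrArg (fun K : T.IdealSheafData => K.ideal ⟨⊤, isAffineOpen_top T⟩) hcomap
  simp only [act, pr] at hC'
  rw [comap_SpecMap_fromSpec_ideal_top, comap_SpecMap_fromSpec_ideal_top] at hC'
  simp only [φa, φp, CommRingCat.hom_ofHom] at hC'
  exact isHomogeneous_of_map_coaction_le 𝒜 ρ hρ (ideal_map_iso_inv_injective _ hC').le

/-- **Torus-stable ⟺ homogeneous** for closed subsets, on a graded affine chart of a locally Noetherian
scheme. [cite: Wlodarczyk2022, Thm. 1.1.4 (6)] -/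
theorem preimage_act_closeds_eq_iff_isHomogeneous [IsLocallyNoetherian Y] (C : Closeds Y) :
    (Spec.map (CommRingCat.ofHom ρ) ≫ W.2.fromSpec) ⁻¹' (C : Set Y) =
      (Spec.map (CommRingCat.ofHom (singleZeroRingHom : Γ(Y, W) →+* (Γ(Y, W) : Type u)[Fin j → ℤ])) ≫
        W.2.fromSpec) ⁻¹' (C : Set Y) ↔
    ((vanishingIdeal C).ideal W).IsHomogeneous 𝒜 :=
  ⟨vanishingIdeal_isHomogeneous_of_preimage_act_eq W 𝒜 ρ hρ C,
    preimage_act_closeds_eq_of_isHomogeneous W 𝒜 ρ hρ C⟩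

/-- **The closed set `Z ∖ Ω` of a torus-stable open in a torus-stable closed set has homogeneous reduced
chart ideal**: `Y` locally Noetherian, `𝓘(Z)(W)` homogeneous, `act⁻¹ Ω = pr⁻¹ Ω` ⇒ `𝓘(Z ⊓ Ωᶜ)(W)` homogeneous.
[folklore] -/
theorem vanishingIdeal_inf_compl_isHomogeneous [IsLocallyNoetherian Y] (Z : Closeds Y)
    (hZ : ((vanishingIdeal Z).ideal W).IsHomogeneous 𝒜) (Ω : Y.Opens)
    (hΩ : (Spec.map (CommRingCat.ofHom ρ) ≫ W.2.fromSpec) ⁻¹' (Ω : Set Y) =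
      (Spec.map (CommRingCat.ofHom (singleZeroRingHom : Γ(Y, W) →+* (Γ(Y, W) : Type u)[Fin j → ℤ])) ≫
        W.2.fromSpec) ⁻¹' (Ω : Set Y)) :
    ((vanishingIdeal (Z ⊓ Ω.compl)).ideal W).IsHomogeneous 𝒜 := by
  refine vanishingIdeal_isHomogeneous_of_preimage_act_eq W 𝒜 ρ hρ _ ?_
  rw [Closeds.coe_inf, Opens.coe_compl, Set.preimage_inter, Set.preimage_inter, Set.preimage_compl,
    Set.preimage_compl, preimage_act_closeds_eq_of_isHomogeneous W 𝒜 ρ hρ Z hZ, hΩ]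

end Torus

/-! ## §4 Torus-stable opens swallow closed orbits -/

section Swallow

open DatumToEmbedded.CentreHomogeneous AddMonoidAlgebra

variable {Y : Scheme.{u}} [IsLocallyNoetherian Y] {α : Type*} (W : α → Y.affineOpens) {j : ℕ}
  (𝒜 : ∀ a, (Fin j → ℤ) → AddSubgroup Γ(Y, W a)) [∀ a, GradedRing (𝒜 a)]
  (ρ : ∀ a, (Γ(Y, W a) : Type u) →+* (Γ(Y, W a) : Type u)[Fin j → ℤ])
  (hρ : ∀ a (i : Fin j → ℤ) (s : Γ(Y, W a)), s ∈ 𝒜 a i → ρ a s = single i s)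
include hρ

/-- **Torus-stable opens swallow closed orbits.**  Let `Y` be locally Noetherian and `Z ⊆ Y` closed and
irreducible with generic point `η`, covered by affine charts `W a` carrying `ℤʲ`-gradings `𝒜 a` with
coactions `ρ a`, such that on every chart the reduced ideal `𝓘(Z)(W a)` is homogeneous (`Z` torus-stable) with
GRADED-SIMPLE quotient (every homogeneous section outside it is a unit modulo it: `Z` is a closed orbit with
finite stabilisers, cf. `gradedSimple_of_degreeZero_of_units`).  Then every open `Ω ∋ η` that is torus-stable on
every chart (`act_a⁻¹ Ω = pr_a⁻¹ Ω`) contains `Z`.  This is the covering step of T-e1-L0 («`Ω := act(T × U)`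
contains the whole orbit `𝒬`») with no density of rational torus points, hence valid over finite fields.
[folklore] -/
theorem closeds_subset_opens_of_gradedSimple_of_stable (Z : Closeds Y) (Ω : Y.Opens) {η : Y}
    (hη : IsGenericPoint η (Z : Set Y)) (hηΩ : η ∈ Ω)
    (hcov : (Z : Set Y) ⊆ ⋃ a, ((W a : Y.Opens) : Set Y))
    (hZ : ∀ a, ((vanishingIdeal Z).ideal (W a)).IsHomogeneous (𝒜 a))
    (hP : ∀ a (i : Fin j → ℤ) ⦃s : Γ(Y, W a)⦄, s ∈ 𝒜 a i → s ∉ (vanishingIdeal Z).ideal (W a) →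
      IsUnit (Ideal.Quotient.mk ((vanishingIdeal Z).ideal (W a)) s))
    (hΩ : ∀ a, (Spec.map (CommRingCat.ofHom (ρ a)) ≫ (W a).2.fromSpec) ⁻¹' (Ω : Set Y) =
      (Spec.map (CommRingCat.ofHom (singleZeroRingHom : Γ(Y, W a) →+* (Γ(Y, W a) : Type u)[Fin j → ℤ])) ≫
        (W a).2.fromSpec) ⁻¹' (Ω : Set Y)) :
    (Z : Set Y) ⊆ Ω :=
  closeds_subset_opens_of_gradedSimple_of_cover W 𝒜 Z Ω hη hηΩ hcov hP fun a =>
    vanishingIdeal_inf_compl_isHomogeneous (W a) (𝒜 a) (ρ a) (hρ a) Z (hZ a) Ω (hΩ a)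

end Swallow

end Summit.ResolutionOfSingularities.ResolutionOfSingularities.Theorems

end
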